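import Literature.MathematicalPhysics.KineticTheory.HardSphereEulerProofs

/-!
# Stub `stub_truncation` of the line `Sketch` (doubling RG) for the crux
`TwoClocks.EquilibriumFastWindowLD` (stmt-AtomisticToContinuum-14440)

Orthogonal bounded truncation with an affordable tail: `F = G + T`, `G = χ F − Σ_k t_k ψ_k` with
`χ(v) = max 0 (min 1 (n + 1 − |v|))`, `t_k(x) = ⟨χ F(x,·), ê_k⟩ = −⟨(1 − χ) F(x,·), ê_k⟩` (so
`|t_k| ≤ C c_u ∫_{|v| ≥ n} W dN(u, θ id) → 0` uniformly in `x`, `W = (1 + |v|²)² + e^{a|v|²}`, `a`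
the Fernique exponent); `G` is orthogonal by duality and re-centring, and for `|μ| ≤ μ₀ = a/(C+1)`
the bound `exp (μ T) ≤ e^{μ₀ K_n} (1 + e^{a} 1_{|v| ≥ n} W)` is integrated under `gaussMeasure u θ`.
-/

noncomputable section

open MeasureTheory ProbabilityTheory Real Set Filter
open scoped ENNReal BigOperators Topology

namespace Summit.AtomisticToContinuum.HydrodynamicLimit.Theorems.FastWindowRG

open Literature.Analysis.FluidPDE Literature.MathematicalPhysics.KineticTheory

/-- Transfer `∫ g dN(u, θ id) = ∫ g M_{1,u,θ} dv` (`withDensity_localMaxwellian_eq_gaussMeasure`;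
as the private transfer lemma of `TwoClocksEquilibriumFastWindowLDStubOneSiteGauss`). -/
private theorem integral_gauss_eq {θ : ℝ} (hθ : 0 < θ) (u : V3) (g : V3 → ℝ) :
    ∫ v, g v ∂(gaussMeasure u θ) = ∫ v, g v * localMaxwellian 1 θ u v := by
  rw [← withDensity_localMaxwellian_eq_gaussMeasure hθ u,
    integral_withDensity_eq_integral_toReal_smul₀
      (continuous_localMaxwellian 1 θ u).measurable.ennreal_ofReal.aemeasurable
      (Eventually.of_forall fun _ => ENNReal.ofReal_lt_top)]
  exact integral_congr_ae (Eventually.of_forall fun v => by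
    simp [ENNReal.toReal_ofReal (localMaxwellian_nonneg zero_le_one hθ.le u v), mul_comm])

/-- A continuous function vanishing outside a ball is integrable (measure finite on compacts). -/
private theorem integrable_of_vanish {ν : Measure V3} [IsFiniteMeasureOnCompacts ν] {φ : V3 → ℝ}
    (hφ : Continuous φ) {R : ℝ} (hR : ∀ v, R ≤ ‖v‖ → φ v = 0) : Integrable φ ν :=
  hφ.integrable_of_hasCompactSupport (HasCompactSupport.intro (isCompact_closedBall (0 : V3) R)
    fun v hv => hR v (by rw [Metric.mem_closedBall, dist_zero_right, not_le] at hv; exact hv.le))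

/-- Continuity in the slow variable of a velocity average with a compactly supported cutoff. -/
private theorem continuous_coeff {ν : Measure V3} [IsFiniteMeasure ν] {χ e : V3 → ℝ}
    {F : T3 × V3 → ℝ} (hχ : Continuous χ) (he : Continuous e) (hF : Continuous F) {R : ℝ}
    (hR : ∀ v, R ≤ ‖v‖ → χ v = 0) : Continuous fun x => ∫ v, χ v * F (x, v) * e v ∂ν := by
  have h : (fun x => ∫ v, χ v * F (x, v) * e v ∂ν) =
      fun x => ∫ v in Metric.closedBall (0 : V3) R, χ v * F (x, v) * e v ∂ν := by
    refine funext fun x => (setIntegral_eq_integral_of_forall_compl_eq_zero fun v hv => ?_).symm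
    rw [Metric.mem_closedBall, dist_zero_right, not_le] at hv
    rw [hR v hv.le, zero_mul, zero_mul]
  rw [h]
  exact continuous_parametric_integral_of_continuous
    (f := fun (x : T3) (v : V3) => χ v * F (x, v) * e v) (by fun_prop) (isCompact_closedBall 0 R)

/-- Integrability of products of quadratic growth against the weight `W ≥ (1 + |v|²)²`. -/
private theorem integrable_growth {ν : Measure V3} {g e W : V3 → ℝ} {C c : ℝ} (hC : 0 ≤ C)
    (hc : 0 ≤ c) (hg : Continuous g) (he : Continuous e) (hgC : ∀ v, |g v| ≤ C * (1 + ‖v‖ ^ 2))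
    (heC : ∀ v, |e v| ≤ c * (1 + ‖v‖ ^ 2)) (hW : Integrable W ν)
    (hWge : ∀ v, (1 + ‖v‖ ^ 2) ^ 2 ≤ W v) : Integrable (fun v => g v * e v) ν := by
  refine (hW.const_mul (C * c)).mono' (by fun_prop) (Eventually.of_forall fun v => ?_)
  rw [Real.norm_eq_abs, abs_mul]
  calc |g v| * |e v| ≤ C * (1 + ‖v‖ ^ 2) * (c * (1 + ‖v‖ ^ 2)) :=
        mul_le_mul (hgC v) (heC v) (abs_nonneg _) (by positivity)
    _ = C * c * (1 + ‖v‖ ^ 2) ^ 2 := by ring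
    _ ≤ C * c * W v := mul_le_mul_of_nonneg_left (hWge v) (by positivity)

/-- Coefficient estimate: for `g ⊥ e`, `⟨χ g, e⟩ = -⟨(1 - χ) g, e⟩` is bounded by a weight tail. -/
private theorem coeff_est {ν : Measure V3} {g e χ W : V3 → ℝ} {C c R : ℝ} (hC : 0 ≤ C)
    (hc : 0 ≤ c) (hg : Continuous g) (he : Continuous e) (hχ : Continuous χ)
    (hgC : ∀ v, |g v| ≤ C * (1 + ‖v‖ ^ 2)) (heC : ∀ v, |e v| ≤ c * (1 + ‖v‖ ^ 2))
    (hχ01 : ∀ v, 0 ≤ χ v ∧ χ v ≤ 1) (hχ1 : ∀ v, ‖v‖ < R → χ v = 1)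
    (hW : Integrable W ν) (hWge : ∀ v, (1 + ‖v‖ ^ 2) ^ 2 ≤ W v) (h0 : ∫ v, g v * e v ∂ν = 0) :
    |∫ v, χ v * g v * e v ∂ν| ≤ C * c * ∫ v in {v : V3 | R ≤ ‖v‖}, W v ∂ν := by
  have hS : MeasurableSet {v : V3 | R ≤ ‖v‖} := measurableSet_le measurable_const measurable_norm
  have hb : ∀ v, |(1 - χ v) * g v * e v| ≤ C * c * W v := fun v => by
    rw [abs_mul, abs_mul, abs_of_nonneg (by linarith [(hχ01 v).2] : (0 : ℝ) ≤ 1 - χ v)]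
    calc (1 - χ v) * |g v| * |e v| ≤ 1 * (C * (1 + ‖v‖ ^ 2)) * (c * (1 + ‖v‖ ^ 2)) :=
          mul_le_mul (mul_le_mul (by linarith [(hχ01 v).1]) (hgC v) (abs_nonneg _) zero_le_one)
            (heC v) (abs_nonneg _) (by positivity)
      _ = C * c * (1 + ‖v‖ ^ 2) ^ 2 := by ring
      _ ≤ C * c * W v := mul_le_mul_of_nonneg_left (hWge v) (by positivity)
  have hi2 : Integrable (fun v => (1 - χ v) * g v * e v) ν := (hW.const_mul (C * c)).mono'
    (by fun_prop) (Eventually.of_forall fun v => by rw [Real.norm_eq_abs]; exact hb v)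
  have hsplit : ∫ v, χ v * g v * e v ∂ν = ∫ v, g v * e v ∂ν - ∫ v, (1 - χ v) * g v * e v ∂ν := by
    rw [← integral_sub (integrable_growth hC hc hg he hgC heC hW hWge) hi2]
    exact integral_congr_ae (Eventually.of_forall fun v => by simp only; ring)
  rw [hsplit, h0, zero_sub, abs_neg]
  calc |∫ v, (1 - χ v) * g v * e v ∂ν| ≤ ∫ v, |(1 - χ v) * g v * e v| ∂ν :=
        abs_integral_le_integral_abs
    _ ≤ ∫ v, {v : V3 | R ≤ ‖v‖}.indicator (fun v => C * c * W v) v ∂ν := by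
        refine integral_mono hi2.abs ((hW.const_mul _).indicator hS) fun v => ?_
        by_cases hv : v ∈ {v : V3 | R ≤ ‖v‖}
        · rw [indicator_of_mem hv]; exact hb v
        · simp [indicator_of_notMem hv, hχ1 v (not_le.1 hv)]
    _ = _ := by rw [integral_indicator hS, integral_const_mul]

/-- Re-centring: orthogonality to `1, v_j - p_j, |v - p|²` transfers to any other centre `q`. -/
private theorem recentre {ν : Measure V3} {g : V3 → ℝ} (p q : V3) (hI0 : Integrable g ν)
    (hI1 : ∀ j, Integrable (fun v => g v * (v j - p j)) ν)
    (hI2 : Integrable (fun v => g v * ‖v - p‖ ^ 2) ν) (h0 : ∫ v, g v ∂ν = 0)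
    (h1 : ∀ j, ∫ v, g v * (v j - p j) ∂ν = 0) (h2 : ∫ v, g v * ‖v - p‖ ^ 2 ∂ν = 0) :
    (∀ j, ∫ v, g v * (v j - q j) ∂ν = 0) ∧ ∫ v, g v * ‖v - q‖ ^ 2 ∂ν = 0 := by
  refine ⟨fun j => ?_, ?_⟩
  · rw [show (fun v => g v * (v j - q j)) = fun v => g v * (v j - p j) + (p j - q j) * g v from
      funext fun v => by ring, integral_add (hI1 j) (hI0.const_mul _), integral_const_mul, h1 j, h0]
    ring
  have hfun : (fun v => g v * ‖v - q‖ ^ 2) = fun v =>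
      g v * ‖v - p‖ ^ 2 + ∑ j, 2 * (p j - q j) * (g v * (v j - p j)) + ‖p - q‖ ^ 2 * g v := by
    funext v; simp only [EuclideanSpace.real_norm_sq_eq, PiLp.sub_apply, Fin.sum_univ_three]; ring
  have iS : Integrable (fun v => ∑ j, 2 * (p j - q j) * (g v * (v j - p j))) ν :=
    integrable_finsetSum _ fun j _ => (hI1 j).const_mul _
  have iA : Integrable (fun v =>
      g v * ‖v - p‖ ^ 2 + ∑ j, 2 * (p j - q j) * (g v * (v j - p j))) ν := hI2.add iS
  rw [hfun, integral_add iA (hI0.const_mul _), integral_add hI2 iS,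
    integral_finsetSum _ fun j _ => (hI1 j).const_mul _]
  simp only [integral_const_mul, h1, h2, h0, mul_zero, Finset.sum_const_zero, add_zero]

/-- Pairing of `φ - Σ_k t_k ψ_k` with a basis function: linearity (compactly supported terms). -/
private theorem integral_corr {ν : Measure V3} [IsFiniteMeasureOnCompacts ν]
    {ψ₀ ψ₂ φ e : V3 → ℝ} {ψ₁ : Fin 3 → V3 → ℝ} {R : ℝ} (hψ₀c : Continuous ψ₀)
    (hψ₂c : Continuous ψ₂) (hψ₁c : ∀ j, Continuous (ψ₁ j)) (hφ : Continuous φ) (he : Continuous e)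
    (hR : ∀ v, R ≤ ‖v‖ → ψ₀ v = 0 ∧ ψ₂ v = 0 ∧ (∀ j, ψ₁ j v = 0) ∧ φ v = 0)
    (t₀ t₂ : ℝ) (t₁ : Fin 3 → ℝ) :
    ∫ v, (φ v - (t₀ * ψ₀ v + ∑ j, t₁ j * ψ₁ j v + t₂ * ψ₂ v)) * e v ∂ν =
      ∫ v, φ v * e v ∂ν - (t₀ * ∫ v, ψ₀ v * e v ∂ν + ∑ j, t₁ j * ∫ v, ψ₁ j v * e v ∂ν +
        t₂ * ∫ v, ψ₂ v * e v ∂ν) := by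
  have iφ : Integrable (fun v => φ v * e v) ν :=
    integrable_of_vanish (hφ.mul he) fun v hv => by rw [(hR v hv).2.2.2, zero_mul]
  have i₀ : Integrable (fun v => ψ₀ v * e v) ν :=
    integrable_of_vanish (hψ₀c.mul he) fun v hv => by rw [(hR v hv).1, zero_mul]
  have i₂ : Integrable (fun v => ψ₂ v * e v) ν :=
    integrable_of_vanish (hψ₂c.mul he) fun v hv => by rw [(hR v hv).2.1, zero_mul]
  have i₁ : ∀ j, Integrable (fun v => ψ₁ j v * e v) ν := fun j =>
    integrable_of_vanish ((hψ₁c j).mul he) fun v hv => by rw [(hR v hv).2.2.1 j, zero_mul]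
  have hfun : (fun v => (φ v - (t₀ * ψ₀ v + ∑ j, t₁ j * ψ₁ j v + t₂ * ψ₂ v)) * e v) = fun v =>
      φ v * e v - (t₀ * (ψ₀ v * e v) + ∑ j, t₁ j * (ψ₁ j v * e v) + t₂ * (ψ₂ v * e v)) := by
    funext v; simp only [Fin.sum_univ_three]; ring
  have iS : Integrable (fun v => ∑ j, t₁ j * (ψ₁ j v * e v)) ν :=
    integrable_finsetSum _ fun j _ => (i₁ j).const_mul _
  have iA : Integrable (fun v => t₀ * (ψ₀ v * e v) + ∑ j, t₁ j * (ψ₁ j v * e v)) ν :=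
    (i₀.const_mul _).add iS
  have iB : Integrable (fun v =>
      t₀ * (ψ₀ v * e v) + ∑ j, t₁ j * (ψ₁ j v * e v) + t₂ * (ψ₂ v * e v)) ν :=
    iA.add (i₂.const_mul _)
  rw [hfun, integral_sub iφ iB, integral_add iA (i₂.const_mul _), integral_add (i₀.const_mul _) iS,
    integral_const_mul, integral_const_mul, integral_finsetSum _ fun j _ => (i₁ j).const_mul _]
  simp only [integral_const_mul]

/-- Crude quadratic bounds: `|v_j - u_j|, |v - u|², 1 ≤ 2 (1 + |u|)² (1 + |v|²)`. -/
private theorem basis_bounds (u v : V3) (j : Fin 3) :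
    |v j - u j| ≤ 2 * (1 + ‖u‖) ^ 2 * (1 + ‖v‖ ^ 2) ∧
      |‖v - u‖ ^ 2| ≤ 2 * (1 + ‖u‖) ^ 2 * (1 + ‖v‖ ^ 2) ∧
      |(1 : ℝ)| ≤ 2 * (1 + ‖u‖) ^ 2 * (1 + ‖v‖ ^ 2) := by
  have hu := norm_nonneg u; have hv := norm_nonneg v
  have huv := mul_nonneg (sq_nonneg ‖u‖) (sq_nonneg ‖v‖)
  have h1 : |v j - u j| ≤ ‖v - u‖ := by
    rw [← PiLp.sub_apply, ← Real.norm_eq_abs]; exact PiLp.norm_apply_le (v - u) j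
  have h2 : ‖v - u‖ ≤ ‖v‖ + ‖u‖ := norm_sub_le v u
  refine ⟨(h1.trans h2).trans ?_, ?_, ?_⟩
  · nlinarith [sq_nonneg (‖v‖ - 1), mul_nonneg hu (sq_nonneg ‖v‖), sq_nonneg ‖u‖, huv]
  · rw [abs_of_nonneg (sq_nonneg _)]
    calc ‖v - u‖ ^ 2 ≤ (‖v‖ + ‖u‖) ^ 2 := pow_le_pow_left₀ (norm_nonneg _) h2 2
      _ ≤ 2 * (1 + ‖u‖) ^ 2 * (1 + ‖v‖ ^ 2) := by
          nlinarith [sq_nonneg (‖v‖ - ‖u‖), mul_nonneg hu (sq_nonneg ‖v‖), huv, mul_nonneg hu hv]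
  · rw [abs_one]; nlinarith [mul_nonneg hu (sq_nonneg ‖v‖), huv]

/-- **NF-a2 `stub_truncation`** (statics). Given a continuous compactly supported dual family to the
centred collision invariants under `M_{1,u,θ}`, every continuous `F` of weighted growth `C`,
`M_{1,u,θ}`-orthogonal at every `x` to `1, v_j, |v|²`, admits a tilt range `μ₀ > 0` such that for
every `ϖ > 0` it splits as `F = G + T`: `G` continuous, of weighted growth `C + 1`, compactly
supported in `v`, orthogonal at every `x`; `∫ exp (μ T(x,·)) dN(u, θ id) ≤ e^{ϖ}` for `|μ| ≤ μ₀`. -/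
theorem stub_truncation {θ : ℝ} (hθ : 0 < θ) (u : V3) {C : ℝ} (hC : 0 ≤ C)
    {ψ₀ ψ₂ : V3 → ℝ} {ψ₁ : Fin 3 → V3 → ℝ}
    (hψ₀c : Continuous ψ₀) (hψ₂c : Continuous ψ₂) (hψ₁c : ∀ j, Continuous (ψ₁ j))
    (hψs : ∃ R : ℝ, ∀ v : V3, R ≤ ‖v‖ → ψ₀ v = 0 ∧ ψ₂ v = 0 ∧ ∀ j, ψ₁ j v = 0)
    (h00 : ∫ v, ψ₀ v * localMaxwellian 1 θ u v = 1)
    (h01 : ∀ j : Fin 3, ∫ v, ψ₀ v * (v j - u j) * localMaxwellian 1 θ u v = 0)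
    (h02 : ∫ v, ψ₀ v * ‖v - u‖ ^ 2 * localMaxwellian 1 θ u v = 0)
    (h10 : ∀ j : Fin 3, ∫ v, ψ₁ j v * localMaxwellian 1 θ u v = 0)
    (h11 : ∀ j l : Fin 3, ∫ v, ψ₁ j v * (v l - u l) * localMaxwellian 1 θ u v = if j = l then 1 else 0)
    (h12 : ∀ j : Fin 3, ∫ v, ψ₁ j v * ‖v - u‖ ^ 2 * localMaxwellian 1 θ u v = 0)
    (h20 : ∫ v, ψ₂ v * localMaxwellian 1 θ u v = 0)
    (h21 : ∀ j : Fin 3, ∫ v, ψ₂ v * (v j - u j) * localMaxwellian 1 θ u v = 0)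
    (h22 : ∫ v, ψ₂ v * ‖v - u‖ ^ 2 * localMaxwellian 1 θ u v = 1)
    (F : T3 × V3 → ℝ) (hF : Continuous F) (hFC : ∀ y, |F y| ≤ C * (1 + ‖y.2‖ ^ 2))
    (hF0 : ∀ x, ∫ v, F (x, v) * localMaxwellian 1 θ u v = 0)
    (hF1 : ∀ x (j : Fin 3), ∫ v, F (x, v) * v j * localMaxwellian 1 θ u v = 0)
    (hF2 : ∀ x, ∫ v, F (x, v) * ‖v‖ ^ 2 * localMaxwellian 1 θ u v = 0) :
    ∃ μ₀ : ℝ, 0 < μ₀ ∧ ∀ ϖ : ℝ, 0 < ϖ → ∃ G T : T3 × V3 → ℝ,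
      (∀ y, F y = G y + T y) ∧ Continuous G ∧ Continuous T ∧
      (∀ y, |G y| ≤ (C + 1) * (1 + ‖y.2‖ ^ 2)) ∧
      (∃ R : ℝ, ∀ y : T3 × V3, R ≤ ‖y.2‖ → G y = 0) ∧
      (∀ x, ∫ v, G (x, v) * localMaxwellian 1 θ u v = 0) ∧
      (∀ x (j : Fin 3), ∫ v, G (x, v) * v j * localMaxwellian 1 θ u v = 0) ∧
      (∀ x, ∫ v, G (x, v) * ‖v‖ ^ 2 * localMaxwellian 1 θ u v = 0) ∧
      (∀ x (μ : ℝ), |μ| ≤ μ₀ →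
        ∫⁻ v, ENNReal.ofReal (Real.exp (μ * T (x, v))) ∂(gaussMeasure u θ) ≤
          ENNReal.ofReal (Real.exp ϖ)) := by
  -- §0 the Fernique weight `W = (1 + |v|²)² + exp (a |v|²)` under `N(u, θ id)` and its tails
  obtain ⟨a, ha, hInt⟩ := IsGaussian.exists_integrable_exp_sq (gaussMeasure u θ)
  obtain ⟨W, hWdef⟩ : ∃ W : V3 → ℝ, W = fun v => (1 + ‖v‖ ^ 2) ^ 2 + Real.exp (a * ‖v‖ ^ 2) :=
    ⟨_, rfl⟩
  have hW : Integrable W (gaussMeasure u θ) := by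
    have I : ∀ k : ℕ, k ≠ 0 → Integrable (fun v : V3 => ‖v‖ ^ k) (gaussMeasure u θ) :=
      fun k hk => (IsGaussian.memLp_id _ k (by simp)).integrable_norm_pow hk
    rw [show W = fun v => (1 + 2 * ‖v‖ ^ 2 + ‖v‖ ^ 4) + Real.exp (a * ‖v‖ ^ 2) by
      rw [hWdef]; funext v; ring]
    exact (((integrable_const 1).add ((I 2 (by simp)).const_mul 2)).add (I 4 (by simp))).add hInt
  have hWb : ∀ v, Real.exp (a * ‖v‖ ^ 2) ≤ W v ∧ (1 + ‖v‖ ^ 2) ^ 2 ≤ W v ∧ 0 ≤ W v := fun v => by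
    rw [hWdef]; exact ⟨le_add_of_nonneg_left (by positivity),
      le_add_of_nonneg_right (Real.exp_pos _).le, by positivity⟩
  have hSm : ∀ n : ℕ, MeasurableSet {v : V3 | (n : ℝ) ≤ ‖v‖} := fun n =>
    measurableSet_le measurable_const measurable_norm
  have hd : Tendsto (fun n : ℕ => ∫ v in {v : V3 | (n : ℝ) ≤ ‖v‖}, W v ∂gaussMeasure u θ)
      atTop (𝓝 0) := by
    have h := Antitone.tendsto_setIntegral hSm (fun m n hmn v hv =>
      show (m : ℝ) ≤ ‖v‖ from (Nat.cast_le.2 hmn).trans hv) hW.integrableOn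
    have he : ⋂ n : ℕ, {v : V3 | (n : ℝ) ≤ ‖v‖} = ∅ :=
      iInter_eq_empty_iff.2 fun v => (exists_nat_gt ‖v‖).imp fun n hn => not_le.2 hn
    rwa [he, Measure.restrict_empty, integral_zero_measure] at h
  have L := integral_gauss_eq hθ u
  obtain ⟨Rψ, hRψ⟩ := hψs
  obtain ⟨B, hB⟩ : ∃ B, ∀ v, ‖|ψ₀ v| + |ψ₂ v| + ∑ j, |ψ₁ j v|‖ ≤ B :=
    Continuous.bounded_above_of_compact_support (by fun_prop)
      (HasCompactSupport.intro (isCompact_closedBall (0 : V3) Rψ) fun v hv => by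
        obtain ⟨h0, h2, h1⟩ := hRψ v
          (by rw [Metric.mem_closedBall, dist_zero_right, not_le] at hv; exact hv.le)
        simp [h0, h2, h1])
  obtain ⟨cu, hcu⟩ : ∃ c : ℝ, c = 2 * (1 + ‖u‖) ^ 2 := ⟨_, rfl⟩
  have hcu0 : 0 ≤ cu := by rw [hcu]; positivity
  have hbu : ∀ v j, |v j - u j| ≤ cu * (1 + ‖v‖ ^ 2) ∧ |‖v - u‖ ^ 2| ≤ cu * (1 + ‖v‖ ^ 2) ∧
      |(1 : ℝ)| ≤ cu * (1 + ‖v‖ ^ 2) := fun v j => by rw [hcu]; exact basis_bounds u v j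
  have hFx : ∀ x, Continuous fun v => F (x, v) := fun x => by fun_prop
  have hFC' : ∀ x v, |F (x, v)| ≤ C * (1 + ‖v‖ ^ 2) := fun x v => hFC (x, v)
  have hF0' : ∀ x, ∫ v, F (x, v) ∂(gaussMeasure u θ) = 0 := fun x => by rw [L]; exact hF0 x
  have hFI : ∀ x, Integrable (fun v => F (x, v)) (gaussMeasure u θ) := fun x => by
    simpa using integrable_growth (e := fun _ => (1 : ℝ)) hC hcu0 (hFx x) continuous_const
      (hFC' x) (fun v => (hbu v 0).2.2) hW fun v => (hWb v).2.1
  have hFc : ∀ x, (∀ j, ∫ v, F (x, v) * (v j - u j) ∂(gaussMeasure u θ) = 0) ∧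
      ∫ v, F (x, v) * ‖v - u‖ ^ 2 ∂(gaussMeasure u θ) = 0 := fun x => by
    refine recentre 0 u (hFI x) (fun j => ?_) ?_ (hF0' x) (fun j => ?_) ?_
    · exact integrable_growth hC (by positivity) (hFx x) (by fun_prop) (hFC' x)
        (fun v => (basis_bounds 0 v j).1) hW fun v => (hWb v).2.1
    · exact integrable_growth hC (by positivity) (hFx x) (by fun_prop) (hFC' x)
        (fun v => (basis_bounds 0 v 0).2.1) hW fun v => (hWb v).2.1
    · simp only [PiLp.zero_apply, sub_zero]; rw [L]; exact hF1 x j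
    · simp only [sub_zero]; rw [L]; exact hF2 x
  -- §1 the tilt range `μ₀ = a / (C + 1)`; given `ϖ`: radius `n`, tail mass `d`, cutoff `χ`, `t_k`
  refine ⟨a / (C + 1), by positivity, fun ϖ hϖ => ?_⟩
  obtain ⟨L₁, hL₁⟩ : ∃ l : ℝ, l = C * cu * B := ⟨_, rfl⟩
  obtain ⟨n, hn1, hn2⟩ := (((hd.const_mul L₁).eventually (gt_mem_nhds (by simp : L₁ * 0 < 1))).and
    ((hd.const_mul (a / (C + 1) * L₁ + Real.exp a)).eventually
      (gt_mem_nhds (by simpa using hϖ : (a / (C + 1) * L₁ + Real.exp a) * 0 < ϖ)))).exists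
  obtain ⟨S, hS⟩ : ∃ S : Set V3, S = {v : V3 | (n : ℝ) ≤ ‖v‖} := ⟨_, rfl⟩
  obtain ⟨d, hdeq⟩ : ∃ d : ℝ, d = ∫ v in S, W v ∂gaussMeasure u θ := ⟨_, rfl⟩
  rw [← hS, ← hdeq] at hn1 hn2
  have hd0 : 0 ≤ d := by rw [hdeq, hS]; exact setIntegral_nonneg (hSm n) fun v _ => (hWb v).2.2
  obtain ⟨χ, hχ⟩ : ∃ χ : V3 → ℝ, χ = fun v => max 0 (min 1 ((n : ℝ) + 1 - ‖v‖)) := ⟨_, rfl⟩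
  have hχc : Continuous χ := by rw [hχ]; fun_prop
  have hχ01 : ∀ v, 0 ≤ χ v ∧ χ v ≤ 1 := fun v => by
    rw [hχ]; exact ⟨le_max_left _ _, max_le zero_le_one (min_le_left _ _)⟩
  have hχ1 : ∀ v, ‖v‖ < (n : ℝ) → χ v = 1 := fun v hv => by
    rw [hχ]; exact (congrArg (max 0) (min_eq_left (by linarith))).trans (max_eq_right zero_le_one)
  have hχ0 : ∀ v, (n : ℝ) + 1 ≤ ‖v‖ → χ v = 0 := fun v hv => by
    rw [hχ]; exact max_eq_left ((min_le_right _ _).trans (by linarith))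
  have hχF : ∀ x v (s : ℝ), 0 ≤ s → s ≤ 1 → |s * F (x, v)| ≤ C * (1 + ‖v‖ ^ 2) :=
    fun x v s h0 h1 => by
    rw [abs_mul, abs_of_nonneg h0]; exact (mul_le_of_le_one_left (abs_nonneg _) h1).trans (hFC' x v)
  obtain ⟨t₀, ht₀⟩ : ∃ t : T3 → ℝ, t = fun x => ∫ v, χ v * F (x, v) ∂gaussMeasure u θ := ⟨_, rfl⟩
  obtain ⟨t₁, ht₁⟩ : ∃ t : Fin 3 → T3 → ℝ,
      t = fun j x => ∫ v, χ v * F (x, v) * (v j - u j) ∂gaussMeasure u θ := ⟨_, rfl⟩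
  obtain ⟨t₂, ht₂⟩ : ∃ t : T3 → ℝ,
      t = fun x => ∫ v, χ v * F (x, v) * ‖v - u‖ ^ 2 ∂gaussMeasure u θ := ⟨_, rfl⟩
  have key := fun x (e : V3 → ℝ) (he : Continuous e) (heC : ∀ v, |e v| ≤ cu * (1 + ‖v‖ ^ 2))
    (h0 : ∫ v, F (x, v) * e v ∂gaussMeasure u θ = 0) =>
    coeff_est hC hcu0 (hFx x) he hχc (hFC' x) heC hχ01 hχ1 hW (fun v => (hWb v).2.1) h0
  have ht₀b : ∀ x, |t₀ x| ≤ C * cu * d := fun x => by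
    rw [ht₀, hdeq, hS]
    simpa using key x (fun _ => 1) continuous_const (fun v => (hbu v 0).2.2) (by simpa using hF0' x)
  have ht₁b : ∀ j x, |t₁ j x| ≤ C * cu * d := fun j x => by
    rw [ht₁, hdeq, hS]; exact key x _ (by fun_prop) (fun v => (hbu v j).1) ((hFc x).1 j)
  have ht₂b : ∀ x, |t₂ x| ≤ C * cu * d := fun x => by
    rw [ht₂, hdeq, hS]; exact key x _ (by fun_prop) (fun v => (hbu v 0).2.1) (hFc x).2
  have ht₀c : Continuous t₀ := by
    rw [ht₀]; simpa using continuous_coeff (ν := gaussMeasure u θ) (e := fun _ => (1 : ℝ)) hχc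
      continuous_const hF hχ0
  have ht₁c : ∀ j, Continuous (t₁ j) := fun j => by
    rw [ht₁]; exact continuous_coeff hχc (by fun_prop) hF hχ0
  have ht₂c : Continuous t₂ := by rw [ht₂]; exact continuous_coeff hχc (by fun_prop) hF hχ0
  obtain ⟨K, hK⟩ : ∃ k : T3 → V3 → ℝ,
      k = fun x v => t₀ x * ψ₀ v + ∑ j, t₁ j x * ψ₁ j v + t₂ x * ψ₂ v := ⟨_, rfl⟩
  have hcorr : ∀ x v, |K x v| ≤ L₁ * d := fun x v => by
    have hΦ := hB v
    rw [Real.norm_eq_abs, abs_of_nonneg (by positivity)] at hΦ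
    have e1 : |∑ j, t₁ j x * ψ₁ j v| ≤ ∑ j, C * cu * d * |ψ₁ j v| :=
      (Finset.abs_sum_le_sum_abs _ _).trans (Finset.sum_le_sum fun j _ => by
        rw [abs_mul]; exact mul_le_mul_of_nonneg_right (ht₁b j x) (abs_nonneg _))
    have e0 := mul_le_mul_of_nonneg_right (ht₀b x) (abs_nonneg (ψ₀ v))
    have e2 := mul_le_mul_of_nonneg_right (ht₂b x) (abs_nonneg (ψ₂ v))
    rw [← abs_mul] at e0 e2; rw [hK]
    calc _ ≤ |t₀ x * ψ₀ v| + |∑ j, t₁ j x * ψ₁ j v| + |t₂ x * ψ₂ v| :=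
          (abs_add_le _ _).trans (add_le_add (abs_add_le _ _) le_rfl)
      _ ≤ C * cu * d * (|ψ₀ v| + |ψ₂ v| + ∑ j, |ψ₁ j v|) := by
          rw [mul_add, mul_add, Finset.mul_sum]; linarith
      _ ≤ L₁ * d := by
          rw [hL₁]; nlinarith [mul_le_mul_of_nonneg_left hΦ (by positivity : 0 ≤ C * cu * d)]
  -- §2 the bounded part `G = χ F - K` (tail `T = F - G`): continuity, support, growth; orthogonal
  obtain ⟨G, hG⟩ : ∃ G : T3 × V3 → ℝ, G = fun y => χ y.2 * F y - K y.1 y.2 := ⟨_, rfl⟩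
  have hGy : ∀ x v, G (x, v) = χ v * F (x, v) - K x v := fun x v => by rw [hG]
  have hGc : Continuous G := by simp only [hG, hK]; fun_prop
  have hvan : ∀ x v, max ((n : ℝ) + 1) Rψ ≤ ‖v‖ →
      ψ₀ v = 0 ∧ ψ₂ v = 0 ∧ (∀ j, ψ₁ j v = 0) ∧ χ v * F (x, v) = 0 := fun x v hv =>
    have h := hRψ v (le_of_max_le_right hv)
    ⟨h.1, h.2.1, h.2.2, by rw [hχ0 v (le_of_max_le_left hv), zero_mul]⟩
  have hGsupp : ∀ y : T3 × V3, max ((n : ℝ) + 1) Rψ ≤ ‖y.2‖ → G y = 0 := fun ⟨x, v⟩ hy => by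
    obtain ⟨h0, h2, h1, h3⟩ := hvan x v hy
    simp [hGy, hK, h0, h2, h1, h3]
  have hGb : ∀ y : T3 × V3, |G y| ≤ (C + 1) * (1 + ‖y.2‖ ^ 2) := fun ⟨x, v⟩ => by
    show |G (x, v)| ≤ (C + 1) * (1 + ‖v‖ ^ 2); rw [hGy]; refine (abs_sub _ _).trans ?_
    nlinarith [hχF x v (χ v) (hχ01 v).1 (hχ01 v).2, (hcorr x v).trans hn1.le, sq_nonneg ‖v‖]
  have hGO : ∀ x, ∫ v, G (x, v) * localMaxwellian 1 θ u v = 0 ∧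
      (∀ j, ∫ v, G (x, v) * v j * localMaxwellian 1 θ u v = 0) ∧
      ∫ v, G (x, v) * ‖v‖ ^ 2 * localMaxwellian 1 θ u v = 0 := by
    intro x
    have hφ : Continuous fun v => χ v * F (x, v) := by fun_prop
    have corr := fun (e : V3 → ℝ) (he : Continuous e) => integral_corr (ν := gaussMeasure u θ)
      hψ₀c hψ₂c hψ₁c hφ he (hvan x) (t₀ x) (t₂ x) (fun j => t₁ j x)
    have c0 : ∫ v, G (x, v) ∂gaussMeasure u θ = 0 := by
      have h := corr (fun _ => 1) continuous_const
      simp only [mul_one, L, h00, h10, h20, mul_zero, Finset.sum_const_zero, add_zero] at h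
      rw [← show t₀ x = ∫ v, χ v * F (x, v) * localMaxwellian 1 θ u v by rw [ht₀]; exact L _,
        sub_self] at h
      rw [L]; simp only [hGy, hK]; exact h
    have c1 : ∀ l, ∫ v, G (x, v) * (v l - u l) ∂gaussMeasure u θ = 0 := fun l => by
      have h := corr (fun v => v l - u l) (by fun_prop)
      simp only [L, h01, h21, h11, mul_ite, mul_one, mul_zero, Finset.sum_ite_eq',
        Finset.mem_univ, if_true, zero_add, add_zero] at h
      rw [← show t₁ l x = ∫ v, χ v * F (x, v) * (v l - u l) * localMaxwellian 1 θ u v by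
        rw [ht₁]; exact L _, sub_self] at h
      rw [L]; simp only [hGy, hK]; exact h
    have c2 : ∫ v, G (x, v) * ‖v - u‖ ^ 2 ∂gaussMeasure u θ = 0 := by
      have h := corr (fun v => ‖v - u‖ ^ 2) (by fun_prop)
      simp only [L, h02, h22, h12, mul_zero, Finset.sum_const_zero, mul_one, zero_add] at h
      rw [← show t₂ x = ∫ v, χ v * F (x, v) * ‖v - u‖ ^ 2 * localMaxwellian 1 θ u v by
        rw [ht₂]; exact L _, sub_self] at h
      rw [L]; simp only [hGy, hK]; exact h
    have hGv : ∀ v, max ((n : ℝ) + 1) Rψ ≤ ‖v‖ → G (x, v) = 0 := fun v hv => hGsupp (x, v) hv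
    have r := recentre u 0 (integrable_of_vanish (by fun_prop) hGv)
      (fun j => integrable_of_vanish (by fun_prop) fun v hv => by rw [hGv v hv, zero_mul])
      (integrable_of_vanish (by fun_prop) fun v hv => by rw [hGv v hv, zero_mul]) c0 c1 c2
    exact ⟨by rw [← L]; exact c0, fun j => by simpa only [PiLp.zero_apply, sub_zero, L] using r.1 j,
      by simpa only [sub_zero, L] using r.2⟩
  -- §3 assembly; the tail: `exp (μ T) ≤ e^{c₀} (1 + e^{a} 1_S W)` pointwise, then integrated
  refine ⟨G, fun y => F y - G y, fun y => by ring, hGc, hF.sub hGc, hGb, ⟨_, hGsupp⟩,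
    fun x => (hGO x).1, fun x j => (hGO x).2.1 j, fun x => (hGO x).2.2, fun x μ hμ => ?_⟩
  show ∫⁻ v, ENNReal.ofReal (Real.exp (μ * (F (x, v) - G (x, v)))) ∂gaussMeasure u θ ≤ _
  obtain ⟨c₀, hc₀⟩ : ∃ c : ℝ, c = a / (C + 1) * (L₁ * d) := ⟨_, rfl⟩
  have hμ₀ : 0 ≤ a / (C + 1) := by positivity
  have hμC : a / (C + 1) * C ≤ a := by
    rw [div_mul_eq_mul_div, div_le_iff₀ (by positivity : (0 : ℝ) < C + 1)]; nlinarith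
  have hT : ∀ v, F (x, v) - G (x, v) = (1 - χ v) * F (x, v) + K x v := fun v => by rw [hGy]; ring
  have hμT : ∀ v, |μ * (F (x, v) - G (x, v))| ≤ a / (C + 1) * (|(1 - χ v) * F (x, v)| + L₁ * d) :=
    fun v => by
    rw [abs_mul, hT]
    exact mul_le_mul hμ ((abs_add_le _ _).trans (by linarith [hcorr x v])) (abs_nonneg _) hμ₀
  have hpt : ∀ v, Real.exp (μ * (F (x, v) - G (x, v))) ≤
      Real.exp c₀ * (1 + Real.exp a * S.indicator W v) := by
    intro v
    refine (Real.exp_le_exp.2 ((le_abs_self _).trans (hμT v))).trans ?_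
    by_cases hv : v ∈ S
    · rw [indicator_of_mem hv]
      refine (Real.exp_le_exp.2 (?_ : _ ≤ c₀ + (a + a * ‖v‖ ^ 2))).trans ?_
      · nlinarith [mul_le_mul_of_nonneg_left (hχF x v (1 - χ v) (by linarith [(hχ01 v).2])
          (by linarith [(hχ01 v).1])) hμ₀,
          mul_le_mul_of_nonneg_right hμC (by positivity : (0 : ℝ) ≤ 1 + ‖v‖ ^ 2)]
      · rw [Real.exp_add, Real.exp_add]; gcongr
        nlinarith [mul_le_mul_of_nonneg_left (hWb v).1 (Real.exp_pos a).le]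
    · rw [indicator_of_notMem hv, mul_zero, add_zero, mul_one, hc₀]
      rw [hS, mem_setOf_eq, not_le] at hv
      rw [hχ1 v hv, sub_self, zero_mul, abs_zero, zero_add]
  have hiS : Integrable (fun v => Real.exp a * S.indicator W v) (gaussMeasure u θ) :=
    (hW.indicator (hS ▸ hSm n)).const_mul _
  have hbi : Integrable (fun v => Real.exp c₀ * (1 + Real.exp a * S.indicator W v))
      (gaussMeasure u θ) := ((integrable_const 1).add hiS).const_mul _
  have hbnn : ∀ v, 0 ≤ Real.exp c₀ * (1 + Real.exp a * S.indicator W v) := fun v => by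
    have := indicator_nonneg (s := S) (fun v _ => (hWb v).2.2) v; positivity
  calc ∫⁻ v, ENNReal.ofReal (Real.exp (μ * (F (x, v) - G (x, v)))) ∂gaussMeasure u θ
      ≤ ∫⁻ v, ENNReal.ofReal (Real.exp c₀ * (1 + Real.exp a * S.indicator W v)) ∂gaussMeasure u θ :=
        lintegral_mono fun v => ENNReal.ofReal_le_ofReal (hpt v)
    _ = ENNReal.ofReal (Real.exp c₀ * (1 + Real.exp a * d)) := by
        rw [← ofReal_integral_eq_lintegral_ofReal hbi (Eventually.of_forall hbnn),
          integral_const_mul, integral_add (integrable_const _) hiS, integral_const_mul,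
          integral_indicator (hS ▸ hSm n), ← hdeq]
        simp
    _ ≤ ENNReal.ofReal (Real.exp c₀ * Real.exp (Real.exp a * d)) := by
        gcongr; linarith [Real.add_one_le_exp (Real.exp a * d)]
    _ ≤ ENNReal.ofReal (Real.exp ϖ) := ENNReal.ofReal_le_ofReal (by
        rw [← Real.exp_add, hc₀]; exact Real.exp_le_exp.2 (by nlinarith [hn2]))

end Summit.AtomisticToContinuum.HydrodynamicLimit.Theorems.FastWindowRG
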